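import Mathlib
import Literature.NumberTheory.LFunctions.Zhang2022.TypedSection16ALeaves
import Literature.NumberTheory.LFunctions.Zhang2022.Section15Bcoef
import Literature.NumberTheory.LFunctions.Zhang2022.Section14MeanSquareLowerBound
import Literature.NumberTheory.LFunctions.Zhang2022.Section16Eval1617
import Literature.NumberTheory.LFunctions.Zhang2022.Section16Endgame
import HarnessLib

/-!
# Zhang (2022), §16 (16.2): "It follows by Proposition 14.1 that `Φ₂ = Σ_{p∼P}(pt₀)^{β₁}Φ₂(p) + o(𝔓)`"
# — the edge `Prop. 14.1 + u010 ⇒ (16.2)`, kernel-checked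

Topic `Literature/NumberTheory/LFunctions/Zhang2022` (Landau–Siegel audit tree; verdict-neutral).
Y. Zhang, *Discrete mean estimates and the Landau–Siegel zero*, arXiv:2211.02515v1 (2022)
[Zhang2022LandauSiegel] — **an unrefereed manuscript under adjudication**; the nodes are CLAIM nodes of
`SkeletonPartThree` / `Typed.Section16A`, stated not asserted. §16 p. 89 (tex L4445–L4462, DAG
`Z22:§16.u010`, `Z22:(16.2)`, `Z22:(16.3)`):

> We can rewrite (16.1) as `Φ₂ = Θ₂(β₁, 𝐤₂*, 𝐚₂*) + o(p)` with `κ₂* = κ₂∗b₁` and `a₂* = g̃₂`. It follows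
> by Proposition 14.1 that `Φ₂ = Σ_{p∼P}(pt₀)^{β₁}Φ₂(p) + o(𝔓)` (16.2) where `Φ₂(p) = …` (16.3).

PROVED here as the kernel edge `eq16_2_of_prop141 : Skeleton.Prop141 → Typed.Section16A.Step16_u010 c′ →
Typed.Section16A.Eq16_2 c′`, discharging what "It follows by Proposition 14.1" leaves implicit:
(i) the hypotheses (14.1)–(14.2) of Proposition 14.1 for `𝐤₂* = κ₂ ∗ b₁`, `𝐚₂* = g̃₂` —
`|κ₂*(m)| ≤ C_bτ₅(m)` (`norm_kappa2Star_le`: `|κ₂| ≤ τ₂` termwise from `κ₂ = n^{−β₁}∗μ`; `|b₁| ≤ C_bτ₃`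
from (15.2) `|b| ≤ C_bτ₂` (the tree's `Skeleton.norm_bcoef_le`, `C_b = (1+|ι₂|)(|ι₃|+|ι₄|)`) and
`|l^{−β₃}g*(T²/l)| ≤ 1`; the tree's `MeanSquareMajorant.norm_seqConv_le_tau`), `|g̃₂(n)| ≤ 1` and
`g̃₂(n) = 0` for `n > 2P₄` (`Typed.Section16ALeaves.gTilde16_eq_zero_of_le`), `|β₁| < 5α`;
(ii) the exact identity `main141 χ β₁ κ₂* g̃₂ = Σ_{p∼P}(pt₀)^{β₁}Φ₂(p)` (`main141_kappa2Star_eq`: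
the main term of Proposition 14.1 is (16.3) summed over the window, after exchanging the `d`- and
`k`-sums). Nothing upstream (Prop. 14.1, (16.1), u010) is asserted; nothing about Theorems 1–2.

## References

* Y. Zhang, arXiv:2211.02515v1 (2022), §16 (16.1)–(16.3) p. 89; §14 Prop. 14.1, (14.1)–(14.2) p. 76;
  §15 (15.2) p. 79. [cite: Zhang2022LandauSiegel, §16 (16.2) p.89]
-/

noncomputable section

open Complex Real

namespace Literature.NumberTheory.LFunctions.Zhang2022.Skeleton

section Majorants

variable (c' : ℝ) {D : ℕ} (χ : DirichletCharacter ℂ D)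

/-- `|κ₂(n)| ≤ τ₂(n)` for `n ≥ 1` (`κ₂ = n^{−iβ}∗μ`: every term of the convolution has modulus `≤ 1`).
[cite: Zhang2022LandauSiegel, §16 p.89] -/
theorem norm_kappa2AF_le (b₁ : ℝ) (n : ℕ) :
    ‖MeanSquareMajorant.kappa₂ b₁ n‖ ≤ 1 * MeanSquareMajorant.tau 2 n := by
  have hcard : (n.divisorsAntidiagonal.card : ℝ) = n.divisors.card := by
    rw [← Nat.map_div_right_divisors, Finset.card_map]
  rw [one_mul, MeanSquareMajorant.kappa₂, ArithmeticFunction.mul_apply, MeanSquareMajorant.tau_two_apply,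
    ← hcard]
  calc ‖∑ x ∈ n.divisorsAntidiagonal, MeanSquareMajorant.powI b₁ x.1 *
        (ArithmeticFunction.moebius : ArithmeticFunction ℂ) x.2‖
      ≤ ∑ x ∈ n.divisorsAntidiagonal, ‖MeanSquareMajorant.powI b₁ x.1 *
          (ArithmeticFunction.moebius : ArithmeticFunction ℂ) x.2‖ := norm_sum_le _ _
    _ ≤ ∑ x ∈ n.divisorsAntidiagonal, (1 : ℝ) := Finset.sum_le_sum fun x hx => by
        obtain ⟨hx1, -⟩ := Nat.ne_zero_of_mem_divisorsAntidiagonal hx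
        rw [norm_mul, MeanSquareMajorant.norm_powI_of_pos b₁ (Nat.pos_of_ne_zero hx1), one_mul]
        exact norm_moebius_complex_le_one _
    _ = (n.divisorsAntidiagonal.card : ℝ) := by simp

/-- `|g*(y)| ≤ 1` (`g* = g·1_{y>1/2}`, `0 < g < 1`), for `𝓛 > 0`. [cite: Zhang2022LandauSiegel, §6 p.30] -/
theorem abs_gstar_le_one (hℓ : 0 < ell D) (y : ℝ) : |gstar D y| ≤ 1 := by
  unfold gstar
  split_ifs with h
  · have hΛ : 0 < ell D ^ 30 := pow_pos hℓ _
    rw [gW, abs_of_pos (GaussWeight.gWeight_pos hΛ _)]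
    exact (GaussWeight.gWeight_lt_one hΛ _).le
  · simp

/-- The first factor of `b₁`: `|l^{−β₃}g*(T²/l)| ≤ 1 = τ₁(l)` for `l ≥ 1`.
[cite: Zhang2022LandauSiegel, §16 p.89 (u007)] -/
theorem norm_b1_factor_le (hℓ : 0 < ell D) {l : ℕ} (hl : l ≠ 0) :
    ‖(l : ℂ) ^ (-beta3 c' D) * (gstar D (bigT D ^ 2 / l) : ℂ)‖ ≤ 1 * MeanSquareMajorant.tau 1 l := by
  rw [MeanSquareMajorant.tau_one_apply hl, one_mul, norm_mul,
    Complex.norm_natCast_cpow_of_pos (Nat.pos_of_ne_zero hl), Complex.norm_real, Real.norm_eq_abs]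
  have hre : (-beta3 c' D).re = 0 := by simp [beta3]
  rw [hre, Real.rpow_zero, one_mul]
  exact abs_gstar_le_one hℓ _

/-- **`|b₁(n)| ≤ C_bτ₃(n)`**, `C_b = (1+|ι₂|)(|ι₃|+|ι₄|)` (`b₁ = (l^{−β₃}g*(T²/l)) ∗ (bχ)`, (15.2)
`|b| ≤ C_bτ₂`), for `𝓛 ≥ 2`. [cite: Zhang2022LandauSiegel, §16 p.89 (u007)] -/
theorem norm_b1coef_le (hℓ : 2 ≤ ell D) (n : ℕ) :
    ‖Typed.Section16A.b1coef c' χ n‖ ≤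
      1 * ((1 + ‖iota2‖) * (‖iota3‖ + ‖iota4‖)) * MeanSquareMajorant.tau 3 n := by
  have hℓ0 : 0 < ell D := by linarith
  have hb : Typed.Section16A.b1coef c' χ n = MeanSquareMajorant.seqConv
      (fun l => (l : ℂ) ^ (-beta3 c' D) * (gstar D (bigT D ^ 2 / l) : ℂ))
      (fun m => bcoef D m * χ (m : ZMod D)) n := rfl
  rw [hb]
  refine MeanSquareMajorant.norm_seqConv_le_tau (j₁ := 1) (j₂ := 2) zero_le_one
    (fun l hl => norm_b1_factor_le c' hℓ0 hl) (fun m _ => ?_) n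
  rw [norm_mul]
  calc ‖bcoef D m‖ * ‖χ (m : ZMod D)‖ ≤ ((1 + ‖iota2‖) * (‖iota3‖ + ‖iota4‖)) *
        MeanSquareMajorant.tau 2 m * 1 :=
        mul_le_mul (norm_bcoef_le hℓ m) (DirichletCharacter.norm_le_one χ _) (norm_nonneg _)
          (mul_nonneg (by positivity) (MeanSquareMajorant.tau_nonneg _ _))
    _ = _ := by ring

/-- **(14.1) for `𝐤₂* = κ₂ ∗ b₁`: `|κ₂*(m)| ≤ C_bτ₅(m)`** (`τ₂ ∗ τ₃ = τ₅`), for `𝓛 ≥ 2`, with `τ₅(m)`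
the coefficient of `ζ⁵` as in `Skeleton.Prop141`. [cite: Zhang2022LandauSiegel, §14 (14.1) p.76] -/
theorem norm_kappa2Star_le (hℓ : 2 ≤ ell D) (m : ℕ) :
    ‖Typed.Section16A.kappa2Star c' χ m‖ ≤
      ((1 + ‖iota2‖) * (‖iota3‖ + ‖iota4‖)) *
        ((ArithmeticFunction.zeta ^ 5 : ArithmeticFunction ℕ) m : ℝ) := by
  have hk : Typed.Section16A.kappa2Star c' χ m = MeanSquareMajorant.seqConv
      (fun a => MeanSquareMajorant.kappa₂ (b1 c' D) a) (Typed.Section16A.b1coef c' χ) m := rfl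
  have h5 : ((ArithmeticFunction.zeta ^ 5 : ArithmeticFunction ℕ) m : ℝ) = MeanSquareMajorant.tau 5 m := by
    rw [MeanSquareMajorant.tau_eq_natCoe_pow, ArithmeticFunction.natCoe_apply]
  rw [hk, h5]
  have h := MeanSquareMajorant.norm_seqConv_le_tau (j₁ := 2) (j₂ := 3) zero_le_one
    (fun a _ => norm_kappa2AF_le (b1 c' D) a) (fun n _ => norm_b1coef_le c' χ hℓ n) m
  norm_num at h
  simpa only [one_mul] using h

/-- **(14.2) for `𝐚₂* = g̃₂`: `|g̃₂(n)| ≤ 1`** (`g̃₂(y) = y^{β₂}g*(P₄/y)`, `β₂` purely imaginary), for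
`𝓛 > 0`. [cite: Zhang2022LandauSiegel, §14 (14.2) p.76] -/
theorem norm_gTilde16_le (hℓ : 0 < ell D) (n : ℕ) : ‖Typed.Section16A.gTilde16 c' D n‖ ≤ 1 := by
  unfold Typed.Section16A.gTilde16
  rw [norm_mul, Complex.norm_real, Real.norm_eq_abs, Complex.ofReal_natCast]
  have hpow : ‖(n : ℂ) ^ beta2 c' D‖ ≤ 1 := by
    rcases Nat.eq_zero_or_pos n with h0 | hpos
    · subst h0
      rw [Nat.cast_zero]
      by_cases hβ : beta2 c' D = 0
      · rw [hβ, Complex.cpow_zero, norm_one]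
      · rw [Complex.zero_cpow hβ, norm_zero]; exact zero_le_one
    · rw [Complex.norm_natCast_cpow_of_pos hpos]
      have hre : (beta2 c' D).re = 0 := by simp [beta2]
      rw [hre, Real.rpow_zero]
  calc ‖(n : ℂ) ^ beta2 c' D‖ * |gstar D (P4 D / n)| ≤ 1 * 1 :=
        mul_le_mul hpow (abs_gstar_le_one hℓ _) (abs_nonneg _) zero_le_one
    _ = 1 := by ring

end Majorants

/-! ## The main term of Proposition 14.1 at `(β₁, κ₂*, g̃₂)` is (16.3) summed over the window -/

section MainTerm

variable (c' : ℝ) {D : ℕ} [NeZero D] (χ : DirichletCharacter ℂ D)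

omit [NeZero D] in
/-- **`main141 χ β₁ κ₂* g̃₂ = Σ_{p∼P}(pt₀)^{β₁}Φ₂(p)`** — the main term of Proposition 14.1
(`Skeleton.main141`) at `β = β₁`, `𝐤* = κ₂∗b₁`, `𝐚* = g̃₂` is exactly the window sum of (16.3)
(`Typed.Section16A.Phi2p`) weighted by `(pt₀)^{β₁}`: exchange the finite `d`- and `k`-sums and
reassociate. [cite: Zhang2022LandauSiegel, §16 (16.2)–(16.3) p.89] -/
theorem main141_kappa2Star_eq :
    main141 χ (beta1 c' D) (Typed.Section16A.kappa2Star c' χ)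
        (fun n => Typed.Section16A.gTilde16 c' D n) =
      ∑ p ∈ primeWindow D, (((p : ℝ) * t0 D : ℝ) : ℂ) ^ beta1 c' D * Typed.Section16A.Phi2p c' χ p := by
  unfold main141 Typed.Section16A.Phi2p
  simp only [Finset.mul_sum]
  refine Finset.sum_congr rfl fun p _ => ?_
  rw [Finset.sum_comm]
  refine Finset.sum_congr rfl fun k _ => Finset.sum_congr rfl fun d _ => ?_
  have hT : (∑' l : ℕ, if Nat.Coprime l k then
        χ (l : ZMod D) * Typed.Section16A.kappa2Star c' χ (d * l) *
          DeltaW D ((l : ℝ) / ((D : ℝ) * p * k)) else 0) =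
      ∑' l : ℕ, if Nat.Coprime l k then
        Typed.Section16A.kappa2Star c' χ (d * l) * χ (l : ZMod D) *
          DeltaW D ((l : ℝ) / ((D : ℝ) * p * k)) else 0 :=
    tsum_congr fun l => by split_ifs <;> ring
  rw [hT]
  ring

end MainTerm

/-! ## (16.2) from Proposition 14.1 and u010 -/

section Edge

variable (c' : ℝ)

/-- **(16.2) ⇐ Proposition 14.1 + u010** ("It follows by Proposition 14.1 that
`Φ₂ = Σ_{p∼P}(pt₀)^{β₁}Φ₂(p) + o(𝔓)`", §16 p. 89, tex L4447–L4449, DAG `Z22:(16.2)` ⇐ `Z22:Prop14.1` +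
`Z22:§16.u010`): kernel edge `Skeleton.Prop141 → Typed.Section16A.Step16_u010 c′ → Typed.Section16A.Eq16_2 c′`.
The hypotheses (14.1)–(14.2) of Proposition 14.1 for `(κ₂*, g̃₂)` and `|β₁| < 5α` are DISCHARGED here
(`norm_kappa2Star_le`, `norm_gTilde16_le`, `Typed.Section16ALeaves.gTilde16_eq_zero_of_le`,
`Skeleton.norm_beta1_bounds`), and the main term is identified by `main141_kappa2Star_eq`.
[cite: Zhang2022LandauSiegel, §16 (16.2) p.89] -/
theorem eq16_2_of_prop141 (h141 : Prop141) (h010 : Typed.Section16A.Step16_u010 c') :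
    Typed.Section16A.Eq16_2 c' := by
  intro ε hε
  set Cb : ℝ := (1 + ‖iota2‖) * (‖iota3‖ + ‖iota4‖) with hCb
  have hCb0 : 0 ≤ Cb := by positivity
  have hε2 : 0 < ε / 2 := by positivity
  obtain ⟨D₁, h₁⟩ := h141 (max 1 Cb) (ε / 2) hε2
  obtain ⟨D₂, h₂⟩ := h010 (ε / 2) hε2
  obtain ⟨D₃, h₃⟩ := exists_forall_le_ell (max 3 (10 * π * |c'| + 1))
  refine ⟨max (max D₁ D₂) D₃, fun D _ χ hD hq hp hA => ?_⟩
  have hT := h₃ D (le_trans (le_max_right _ _) hD)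
  have hℓ3 : 3 ≤ ell D := le_trans (le_max_left _ _) hT
  have hℓc : 10 * π * |c'| + 1 ≤ ell D := le_trans (le_max_right _ _) hT
  have hℓ1 : 1 ≤ ell D := by linarith
  have hℓ0 : 0 < ell D := by linarith
  have hα9 : alpha D * ell D ^ 9 = π := alpha_mul_ell_pow_nine hℓ0
  have hα : 0 < alpha D := alpha_pos_of_ell_pos hℓ0
  -- `|β₁| < 5α`: `5|c′|α𝓛 ≤ 1/2` since `α𝓛 ≤ π/𝓛` and `𝓛 ≥ 10π|c′| + 1`
  have hαℓ : alpha D * ell D ≤ π / ell D := by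
    rw [le_div_iff₀ hℓ0, ← hα9]
    have h29 : ell D * ell D ≤ ell D ^ 9 := by
      calc ell D * ell D = ell D ^ 2 := by ring
        _ ≤ ell D ^ 9 := pow_le_pow_right₀ hℓ1 (by norm_num)
    calc alpha D * ell D * ell D = alpha D * (ell D * ell D) := by ring
      _ ≤ alpha D * ell D ^ 9 := mul_le_mul_of_nonneg_left h29 hα.le
  have h5 : 5 * |c'| * (alpha D * ell D) ≤ 1 / 2 := by
    have h5' : 5 * |c'| * (π / ell D) ≤ 1 / 2 := by
      rw [mul_div_assoc', div_le_iff₀ hℓ0]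
      nlinarith [abs_nonneg c', Real.pi_pos]
    exact le_trans (mul_le_mul_of_nonneg_left hαℓ (by positivity)) h5'
  obtain ⟨-, hβ1u⟩ := norm_beta1_bounds c' hα.le (by positivity) h5
  have hβ : ‖beta1 c' D‖ < 5 * alpha D := by linarith
  -- the hypotheses (14.1)–(14.2) of Proposition 14.1 for `(κ₂*, g̃₂)`
  have hκ : ∀ m : ℕ, ‖Typed.Section16A.kappa2Star c' χ m‖ ≤
      max 1 Cb * ((ArithmeticFunction.zeta ^ 5 : ArithmeticFunction ℕ) m : ℝ) := fun m =>
    (norm_kappa2Star_le c' χ (by linarith) m).trans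
      (mul_le_mul_of_nonneg_right (le_max_right _ _) (Nat.cast_nonneg _))
  have ha : ∀ n : ℕ, ‖(fun n : ℕ => Typed.Section16A.gTilde16 c' D n) n‖ ≤ max 1 Cb := fun n =>
    (norm_gTilde16_le c' hℓ0 n).trans (le_max_left _ _)
  have hz : ∀ n : ℕ, 2 * P4 D < n → (fun n : ℕ => Typed.Section16A.gTilde16 c' D n) n = 0 := by
    intro n hn
    have hn0 : (0 : ℝ) < n := lt_of_le_of_lt (by linarith [Typed.Section16ALeaves.P4_nonneg D]) hn
    exact Typed.Section16ALeaves.gTilde16_eq_zero_of_le c' hn0 hn.le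
  have e141 := h₁ D χ (le_trans (le_trans (le_max_left _ _) (le_max_left _ _)) hD) hq hp hA
    (beta1 c' D) hβ (Typed.Section16A.kappa2Star c' χ) (fun n => Typed.Section16A.gTilde16 c' D n)
    hκ ha hz
  rw [main141_kappa2Star_eq] at e141
  have e010 := h₂ D χ (le_trans (le_trans (le_max_right _ _) (le_max_left _ _)) hD) hq hp hA
  rw [← sub_add_sub_cancel (Phi2 c' χ)
    (Theta2 χ (beta1 c' D) (Typed.Section16A.kappa2Star c' χ)
      (fun n => Typed.Section16A.gTilde16 c' D n))
    (∑ p ∈ primeWindow D, (((p : ℝ) * t0 D : ℝ) : ℂ) ^ beta1 c' D * Typed.Section16A.Phi2p c' χ p)]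
  calc _ ≤ ε / 2 * frakP D + ε / 2 * frakP D := (norm_add_le _ _).trans (add_le_add e010 e141)
    _ = ε * frakP D := by ring

end Edge

end Literature.NumberTheory.LFunctions.Zhang2022.Skeleton
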